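import Literature.Combinatorics.SimpleGraph.TreeAutomorphismFixedPoints   -- ★ `apply_eq_self_of_mem_support`, `isTree_induce_fixed` (any vertex type), `exists_fixed_vertex_of_coloring` (finite trees)
import HarnessLib

/-!
# A ROOTED CRITERION for a graph to be a tree; the EULER COUNT `#V = #E + 1` of the fixed subtree of an automorphism of an INFINITE tree; and the
# FIXED-POINT THEOREM for a colour-preserving automorphism with a finite invariant set (Serre, *Trees*, I.2.2, I.6.1, I.6.5)

Topic `Combinatorics/SimpleGraph`; namespace `Literature.Combinatorics.SimpleGraph.RootedTree`.  THEOREMS ONLY (no definition, no instance, no notation, no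
named fact, no `sorry`), for an ARBITRARY vertex type.  The finite-tree statements (Hopf trace ∕ Lefschetz count, `exists_fixed_vertex_of_coloring`) are ★
`Literature/Combinatorics/SimpleGraph/TreeAutomorphismFixedPoints.lean`, whose subtree lemmas `apply_eq_self_of_mem_support`, `connected_induce_fixed`,
`isTree_induce_fixed` already hold without finiteness and are reused here.  Consumer: the Bruhat–Tits TREE of a rank-one `p`-adic unitary group (infinitely
many vertices; an elliptic regular `γ` has FINITELY many fixed vertices) — cell `pub/hodgecm-mathlib`, crux H413 (stmt-HodgeConjecture-24833), line «N6nsGerm»,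
the Euler–Poincaré road (R2): the ELLIPTIC relation `#Fix(G⧸K) + #Fix(G⧸K′) = #Fix(G⧸I) + 1` of ★ `Rogawski1990/RankOneEulerPoincareGlue` is §2's count on
the tree of `U(Φ₂)(L⁺_v)` (A-p17 (g22) ∕ A-p06 (g27), LEAD F0P3a-plan (g10) T9-6).

* §1 **`isTree_of_parent`** — ROOTED CRITERION: a root `r`, a depth `d : V → ℕ` and a parent map `p` with `v ~ p v`, `d (p v) + 1 = d v` for `v ≠ r`, such
  that EVERY edge joins a non-root vertex to its parent ⇒ `G` is a tree (connected: climb to the root; acyclic: at a vertex of maximal depth on a cycle both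
  cycle-neighbours would be its parent, but they are distinct — Mathlib `IsCycle.snd_ne_penultimate`).
* §2 **`ncard_fixedPoints_eq_ncard_fixedEdges_add_one`** — for a tree `G` and `α : G ≃g G` whose fixed vertex set is finite and non-empty,
  `#{v | α v = v} = #{e ∈ E(G) | both ends fixed} + 1` (the fixed set induces a finite tree, ★ `isTree_induce_fixed`; Mathlib `IsTree.card_edgeFinset`).
* §3 **`exists_fixedPoint_of_finite_invariant`** — an automorphism of a tree preserving a proper `2`-colouring and leaving a finite non-empty vertex set
  invariant FIXES A VERTEX (the hull of the invariant set — the union of the paths between its points — is a finite invariant subtree; ★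
  `exists_fixed_vertex_of_coloring` on it): Serre's «a bounded group acting without inversion on a tree fixes a vertex», cyclic case.

References: [Serre1980Trees] J.-P. Serre, *Trees* (1980), I.2.2 Prop. 8, I.6.1, I.6.5 Prop. 19 ∕ Cor.; [Meier2008] J. Meier, *Groups, Graphs and Trees* (2008),
Thm. 3.46, Cor. 3.47, Lemma 3.50; [Diestel2010] R. Diestel, *Graph Theory*, 4th ed., Prop. 1.5.2, Cor. 1.5.3, Ch. 1 Ex. 16.
-/

set_option autoImplicit false

open SimpleGraph Set Finset
open Literature.Combinatorics.SimpleGraph.BakerNorine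

namespace Literature.Combinatorics.SimpleGraph.RootedTree

variable {V : Type*} {G : SimpleGraph V}

/-! ## §1 The rooted criterion -/

section Rooted

/-- **ROOTED TREE CRITERION.**  Let `r` be a root, `d` a depth and `p` a parent map such that every `v ≠ r` is adjacent to `p v` with `d (p v) + 1 = d v`,
and every edge `{v, w}` is a parent edge (`v ≠ r ∧ p v = w`, or `w ≠ r ∧ p w = v`).  Then `G` is a tree. [cite: Serre1980Trees, I.2.2 Prop. 8] [cite: Diestel2010, Prop. 1.5.2] -/
theorem isTree_of_parent (r : V) (d : V → ℕ) (p : V → V) (hp : ∀ v, v ≠ r → G.Adj v (p v) ∧ d (p v) + 1 = d v)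
    (hedge : ∀ v w, G.Adj v w → (v ≠ r ∧ p v = w) ∨ (w ≠ r ∧ p w = v)) : G.IsTree := by
  classical
  -- (connected) every vertex reaches the root by climbing the parent chain
  have hreach : ∀ n v, d v = n → G.Reachable v r := by
    intro n
    induction n using Nat.strong_induction_on with
    | _ n ih =>
      intro v hv
      by_cases hvr : v = r
      · subst hvr; exact Reachable.refl _
      · obtain ⟨hadj, hdp⟩ := hp v hvr
        exact hadj.reachable.trans (ih (d (p v)) (by omega) (p v) rfl)
  haveI : Nonempty V := ⟨r⟩
  refine ⟨⟨fun v w => (hreach _ v rfl).trans (hreach _ w rfl).symm⟩, ?_⟩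
  -- (acyclic) along an edge towards the parent the depth drops by one
  have hpar : ∀ v w, G.Adj v w → d w ≤ d v → v ≠ r ∧ p v = w := by
    intro v w h hle
    rcases hedge v w h with hv | ⟨hwr, hpw⟩
    · exact hv
    · exfalso
      obtain ⟨-, hdw⟩ := hp w hwr
      rw [hpw] at hdw
      omega
  intro u c hc
  -- a vertex `m` of maximal depth on the cycle
  obtain ⟨m, hm, hmax⟩ := c.support.toFinset.exists_max_image d ⟨u, List.mem_toFinset.2 c.start_mem_support⟩
  have hm' : m ∈ c.support := List.mem_toFinset.1 hm
  set c' : G.Walk m m := c.rotate m hm' with hc'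
  have hcyc : c'.IsCycle := hc.rotate hm'
  have hnil : ¬ c'.Nil := hcyc.not_nil
  have hsupp : ∀ x, x ∈ c'.support → d x ≤ d m := fun x hx =>
    hmax x (List.mem_toFinset.2 ((Walk.mem_support_rotate_iff c m hm').1 hx))
  -- its two cycle-neighbours are both `p m`
  have h1 : G.Adj m c'.snd := c'.adj_snd hnil
  have h2 : G.Adj m c'.penultimate := (c'.adj_penultimate hnil).symm
  have hs : p m = c'.snd := (hpar m _ h1 (hsupp _ (c'.getVert_mem_support 1))).2
  have hpu : p m = c'.penultimate := (hpar m _ h2 (hsupp _ (c'.getVert_mem_support _))).2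
  exact hcyc.snd_ne_penultimate (hs.symm.trans hpu)

end Rooted

/-! ## §2 The fixed subtree of an automorphism of a tree and its Euler count -/

section Fixed

/-- An edge of `G` with both ends fixed by `α` is an edge of the subgraph induced on the fixed set, and conversely: the edges of the induced subgraph on
`{v | α v = v}` are in bijection with `{e ∈ E(G) | ∀ v ∈ e, α v = v}`. [cite: Meier2008, Lemma 3.50] -/
theorem ncard_edgeSet_induce_fixedPoints (α : G ≃g G) :
    (G.induce {v | α v = v}).edgeSet.ncard = {e ∈ G.edgeSet | ∀ v ∈ e, α v = v}.ncard := by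
  classical
  -- the embedding of the induced subgraph maps its edge set bijectively onto the edges with both ends fixed
  have hinj : Set.InjOn (Sym2.map (Subtype.val : {v | α v = v} → V)) (G.induce {v | α v = v}).edgeSet :=
    fun e _ e' _ h => Sym2.map.injective Subtype.val_injective h
  rw [← hinj.ncard_image]
  congr 1
  ext e
  constructor
  · rintro ⟨e', he', rfl⟩
    induction e' using Sym2.ind with
    | h x y =>
      refine ⟨?_, ?_⟩
      · rw [Sym2.map_mk, mem_edgeSet]; exact (mem_edgeSet _).1 he'
      · intro v hv
        rw [Sym2.map_mk, Sym2.mem_iff] at hv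
        rcases hv with rfl | rfl
        · exact x.2
        · exact y.2
  · rintro ⟨he, hfix⟩
    induction e using Sym2.ind with
    | h x y =>
      refine ⟨s(⟨x, hfix x (Sym2.mem_mk_left _ _)⟩, ⟨y, hfix y (Sym2.mem_mk_right _ _)⟩), ?_, by simp⟩
      rw [mem_edgeSet]; exact (mem_edgeSet _).1 he

/-- **EULER COUNT OF THE FIXED SUBTREE.**  For a tree `G` (any vertex type) and an automorphism `α` whose fixed vertex set is FINITE and NON-EMPTY:
`#{v | α v = v} = #{e ∈ E(G) | both ends fixed} + 1` — the fixed set induces a finite tree (★ `isTree_induce_fixed`), whose edge count is one less than its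
vertex count (Mathlib `IsTree.card_edgeFinset`). [cite: Serre1980Trees, I.6.1] [cite: Meier2008, Lemma 3.50] [cite: Diestel2010, Cor. 1.5.3] -/
theorem ncard_fixedPoints_eq_ncard_fixedEdges_add_one (hT : G.IsTree) (α : G ≃g G) (hfin : {v | α v = v}.Finite) {u : V} (hu : α u = u) :
    {v | α v = v}.ncard = {e ∈ G.edgeSet | ∀ v ∈ e, α v = v}.ncard + 1 := by
  classical
  haveI : Fintype {v | α v = v} := hfin.fintype
  have hTF : (G.induce {v | α v = v}).IsTree := isTree_induce_fixed hT α hu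
  haveI : Fintype (G.induce {v | α v = v}).edgeSet := Fintype.ofFinite _
  have hcard := hTF.card_edgeFinset
  rw [← ncard_edgeSet_induce_fixedPoints α, Set.ncard_eq_toFinset_card' {v | α v = v}, Set.toFinset_card,
    Set.ncard_eq_toFinset_card' (G.induce {v | α v = v}).edgeSet, Set.toFinset_card]
  rw [edgeFinset, Set.toFinset_card] at hcard
  omega

end Fixed

/-! ## §3 The fixed-point theorem: a finite invariant set forces a fixed vertex -/

section FixedPoint

/-- **THE HULL of a finite set of vertices of a tree**: the union of the supports of the paths between its points is finite, contains it, induces a CONNECTED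
subgraph, and is invariant under every automorphism leaving the set invariant. [cite: Serre1980Trees, I.6.5 Prop. 19] [cite: Meier2008, Thm. 3.46] -/
theorem exists_hull_of_finite (hT : G.IsTree) (α : G ≃g G) {S : Set V} (hS : S.Finite) (hSne : S.Nonempty) (hαS : ∀ s ∈ S, α s ∈ S) :
    ∃ H : Set V, H.Finite ∧ S ⊆ H ∧ (G.induce H).Connected ∧ ∀ v ∈ H, α v ∈ H := by
  classical
  -- the path function of the tree
  have hpath : ∀ s t : V, ∃ q : G.Walk s t, q.IsPath := fun s t => (hT.connected s t).exists_isPath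
  choose q hq using hpath
  refine ⟨⋃ s ∈ S, ⋃ t ∈ S, {x | x ∈ (q s t).support}, ?_, ?_, ?_, ?_⟩
  · exact hS.biUnion fun s _ => hS.biUnion fun t _ => (q s t).support.finite_toSet
  · intro s hs
    exact Set.mem_biUnion hs (Set.mem_biUnion hs ((q s s).start_mem_support))
  · -- connected: from `x ∈ path(s,t)` walk to `t`, then along `path(t,s′)`, then along `path(s′,t′)` to `y`
    obtain ⟨s₀, hs₀⟩ := hSne
    have hmem : ∀ {s t x}, s ∈ S → t ∈ S → x ∈ (q s t).support → x ∈ ⋃ s ∈ S, ⋃ t ∈ S, {x | x ∈ (q s t).support} :=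
      fun hs ht hx => Set.mem_biUnion hs (Set.mem_biUnion ht hx)
    refine induce_connected_of_patches s₀ (hmem hs₀ hs₀ (q s₀ s₀).start_mem_support) ?_
    intro x hx
    simp only [Set.mem_iUnion, Set.mem_setOf_eq] at hx
    obtain ⟨s, hs, t, ht, hx⟩ := hx
    -- the walk `s₀ → s → x` inside `path(s₀, s) ∪ path(s, t)`
    let w₁ : G.Walk s₀ s := q s₀ s
    let w₂ : G.Walk s x := (q s t).takeUntil x hx
    refine ⟨{y | y ∈ w₁.support} ∪ {y | y ∈ w₂.support}, ?_, Or.inl w₁.start_mem_support, Or.inr w₂.end_mem_support, ?_⟩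
    · rintro y (hy | hy)
      · exact hmem hs₀ hs hy
      · exact hmem hs ht ((q s t).support_takeUntil_subset_support hx hy)
    · have hconn : (G.induce ({y | y ∈ w₁.support} ∪ {y | y ∈ w₂.support})).Connected :=
        induce_union_connected (w₁.connected_induce_support).preconnected (w₂.connected_induce_support).preconnected
          ⟨s, w₁.end_mem_support, w₂.start_mem_support⟩
      exact hconn.preconnected _ _
  · -- invariance: `α` maps `path(s,t)` onto `path(α s, α t)` (uniqueness of paths in a tree)
    intro v hv
    simp only [Set.mem_iUnion, Set.mem_setOf_eq] at hv ⊢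
    obtain ⟨s, hs, t, ht, hv⟩ := hv
    refine ⟨α s, hαS s hs, α t, hαS t ht, ?_⟩
    have hmap : ((q s t).map α.toHom).IsPath := Walk.IsPath.map (f := α.toHom) α.injective (hq s t)
    have huniq := (hT.existsUnique_path (α s) (α t)).unique hmap (hq (α s) (α t))
    rw [← huniq, Walk.support_map]
    exact List.mem_map.2 ⟨v, hv, rfl⟩

/-- **FIXED-POINT THEOREM (Serre I.6.5, cyclic case; Meier Cor. 3.47).**  Let `G` be a tree with a proper `2`-colouring `c` and `α` an automorphism
PRESERVING the colouring (`c (α v) = c v`: no inversions).  If `α` leaves a finite non-empty set of vertices invariant, then `α` FIXES A VERTEX: the hull of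
the invariant set is a finite invariant subtree, on which the finite-tree theorem ★ `exists_fixed_vertex_of_coloring` applies.
[cite: Serre1980Trees, I.6.5 Prop. 19] [cite: Meier2008, Thm. 3.46, Cor. 3.47] [cite: Diestel2010, Ch. 1 Ex. 16] -/
theorem exists_fixedPoint_of_finite_invariant (hT : G.IsTree) (α : G ≃g G) (c : G.Coloring (Fin 2)) (hc : ∀ v, c (α v) = c v)
    {S : Set V} (hS : S.Finite) (hSne : S.Nonempty) (hαS : ∀ s ∈ S, α s ∈ S) : ∃ v : V, α v = v := by
  classical
  obtain ⟨H, hHf, -, hHc, hHα⟩ := exists_hull_of_finite hT α hS hSne hαS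
  haveI : Fintype H := hHf.fintype
  -- `α` restricts to an automorphism of the finite tree induced on the hull
  have hbij : Set.BijOn α H H := by
    refine (Set.Finite.injOn_iff_bijOn_of_mapsTo hHf (fun v hv => hHα v hv)).1 (α.injective.injOn)
  let e : H ≃ H := hbij.equiv α
  have he : ∀ v : H, ((e v : H) : V) = α v := fun v => rfl
  let αH : G.induce H ≃g G.induce H :=
    { toEquiv := e
      map_rel_iff' := by
        intro a b
        change G.Adj ((e a : H) : V) ((e b : H) : V) ↔ G.Adj (a : V) (b : V)
        rw [he, he]
        exact α.map_adj_iff }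
  have hTH : (G.induce H).IsTree := (isTree_iff _).2 ⟨hHc, hT.isAcyclic.induce _⟩
  -- the restricted colouring is preserved
  let cH : (G.induce H).Coloring (Fin 2) := Coloring.mk (fun v => c v) fun {a b} hab => c.valid hab
  obtain ⟨v, hv⟩ := exists_fixed_vertex_of_coloring hTH αH cH (fun v => hc v)
  exact ⟨v, by rw [← he]; exact congrArg Subtype.val hv⟩

end FixedPoint

end Literature.Combinatorics.SimpleGraph.RootedTree
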